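import Summits.BirchSwinnertonDyer.BirchSwinnertonDyer.Theorems.SignedBaseChangeAnticyclotomicEisensteinDivisibilityAwayDiscrepancyLocal
import Summits.BirchSwinnertonDyer.BirchSwinnertonDyer.Theorems.EisensteinPrimesUnramifiedLeAwayKer
import Summits.BirchSwinnertonDyer.BirchSwinnertonDyer.Theorems.EisensteinPrimesSelmerAcQuotientCorankLeGeneric
import Summits.BirchSwinnertonDyer.BirchSwinnertonDyer.Theorems.EisensteinPrimesGoodLatticeQuotCharUnramified
import Summits.BirchSwinnertonDyer.Rank1Residual.X2.NonPrimitiveSelmerCorank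
import Summits.BirchSwinnertonDyer.Rank1Residual.X11b.CoinvariantsDescent
import Literature.NumberTheory.EllipticCurves.Castella2018.AnticyclotomicSelmerDual
import Literature.NumberTheory.EllipticCurves.KellerYin2024.CharacterSelmerGroups
import Literature.NumberTheory.EllipticCurves.BigRepModuleShapiroSelmerConditionsProofs
import Literature.NumberTheory.EllipticCurves.ZpExtensionUnramifiedProofs
import Literature.NumberTheory.EllipticCurves.TwoVariableSelmerDual
import Literature.NumberTheory.GaloisRepresentations.DecompositionGroupOfCompletion
import HarnessLib

/-!
# Crux `GoodLatticeBDPValue` (stmt-BirchSwinnertonDyer-19032), line `halves` v20, stub `stub_indexPlumbing`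
# part (C): THE DICTIONARIES `λ(𝔛^{Sf}_f) = corank_{ℤ_p} R(E[p^∞])` and `λ(DS.X) = corank_{ℤ_p} S^{Sf}_nr(θ)`

Width seat bsd-line-x1-p1-w5 (gen 0, 2026-08-28), helper for the LEAD's v20 skeleton (`stub_indexPlumbing`,
docstring item (C); V21 road memo `Cruxes/GoodLatticeBDPValue/Lines/halves-imprimLambda-index-road.md` §1 and
§3 (I9)). The mid-level composition `ResidualIndexAssembly.zpCorank_datumStrictSelmer_add_eq` (p645893) speaks of
`zpCorank` of Greenberg–Vatsal STRICT datum Selmer groups `datumStrictSelmer (ker κ) A p (bdpData A p v̄) Sf`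
over `K_∞`, whereas the crux's conclusion speaks of `lambdaInvariant` of Castella's dual `𝔛^{Sf}_f =
AcSelmer.XAc` and of dual data `DS : DatumDualData κ γ ((F/𝒪)(θ)) (bdpData) Sf` of the NON-STRICT
(unramified-at-`v̄`) groups `datumSelmerInfty`. This file supplies the two identifications, sorry-free:

* §1 (any number field `K`, any elliptic `W/K`, any `ℤ_p`-extension `κ`, any `𝔭`, any `S`):
  `selmerAc_le_datumStrictSelmer` — Castella's `Sel_𝔭^S(K_∞, E[p^∞])` lies in GV's strict group
  (`awayKer ≤ unramifiedKer`; the conditions above `p` coincide: strict at `𝔭`, vacuous elsewhere);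
  `datumStrictSelmer_le_selmerAc` — the converse when every infinite place of `K` is complex, `𝔭 ∋ p`,
  and `W` has good reduction at every finite `v ∉ S`, `v ∤ p`: an unramified class is locally trivial at
  such `v` over `K_∞` — at a finitely decomposed `v` because `Gal(K̄_v/K_{∞,w})/I` is pro-prime-to-`p`
  (`UnramifiedLeAwayKer.unramifiedKer_le_awayKer_of_not_decomp_le`), at a completely split GOOD `v` by
  Greenberg's Lemma 3.3 (`mem_awayKer_of_mem_unramifiedKer_of_decomp_le`); hence
  `selmerAc_eq_datumStrictSelmer` — EQUALITY of the two subgroups of `H¹(K_∞, E[p^∞])` (no bounded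
  discrepancy `t` is needed once the unramified condition is only imposed at good places).
* §2 (algebra): `λ(X) = corank_{ℤ_p}(Sel)` and `Sel[p]` finite for `X` a finitely generated torsion
  `Λ`-module with `μ = 0` that is, as a group, the character group of the `p`-primary group `Sel`
  (`X2.NonPrimitiveSelmerCorank.finite_torsionBy_and_zpCorank_eq_lambdaInvariant`), instantiated at
  (a) `X = AcSelmer.XAc W p κ 𝔭 S γ`, which IS `Hom(Sel_𝔭^S, ℚ/ℤ)` (`AddEquiv.refl`), and (b) `X = D.X`
  for ANY `D : GreenbergVatsal2000.DatumDualData κ γ M L S₀` with `M` `p`-primary (`D.toDualEquiv`).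
* §3 (the crux's binders): for `E_K = W.baseChange K`, `K` imaginary quadratic, `vbar ∋ p`,
  `Sf = {w : N_W ∈ w}` (so `W_K` is good at every `w ∉ Sf`, `hasGoodReductionAt_baseChange_of_conductorNorm_notMem`):
  `lambdaInvariant p (XAc E_K p κ vbar ↑Sf γ) = zpCorank (datumStrictSelmer (ker κ) E_K[p^∞] p (bdpData … vbar) ↑Sf) p`
  given `Module.Finite ∧ IsTorsion ∧ μ = 0` of `XAc` (the antecedents of `stub_indexPlumbing`), and
  `lambdaInvariant p DS.X = zpCorank (datumSelmerInfty κ ((F/𝒪)(θ)) (bdpData … vbar) ↑Sf) p` for every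
  dual datum `DS` of a character module `charModule ∅ θ` with the same three antecedents.

Not here: the non-primitive-versus-strict comparison at `v̄` (item (B) of `stub_indexPlumbing`: `+p^c` for
`θquot`, `+0` for `θsub`), the mid-level identity itself, or any statement of the crux / KY Thm. 1.4.1.
No new definition, no named fact, no `sorry`; BSD is not proved by this file.

References: F. Castella, Camb. J. Math. 6 (2018), Def. 2.2 and §2.2 (arXiv:1704.06608 pp. 5, 7);
R. Greenberg, LNM 1716 (1999), §1 p. 60 and §3 Lemma 3.3 (p. 87); R. Greenberg, in *Algebraic Number Theory —
in honor of K. Iwasawa* (1989), §1 p. 98; R. Greenberg, V. Vatsal, Invent. Math. 142 (2000), §2 pp. 15–21;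
T. Keller, M. Yin, arXiv:2402.12781v2, §1.2 and Thm. 1.4.1 (iii).
-/

-- D-0017: single-problem summit, the namespace repeats the problem name by design.
set_option linter.dupNamespace false
set_option autoImplicit false

noncomputable section

open scoped Classical AddSubgroup

open NumberField IsDedekindDomain Field
open Literature.NumberTheory.EllipticCurves Literature.NumberTheory.EllipticCurves.GreenbergSelmer
  Literature.NumberTheory.EllipticCurves.GreenbergVatsal2000 Literature.NumberTheory.GaloisRepresentations
  Literature.NumberTheory.EllipticCurves.Castella2018 IsDedekindDomain.HeightOneSpectrum

namespace Summit.BirchSwinnertonDyer.BirchSwinnertonDyer.Theorems.IndexPlumbingDictionary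

open Summit.BirchSwinnertonDyer.BirchSwinnertonDyer.Theorems

/-! ## §1 Castella's `Sel_𝔭^S(K_∞, E[p^∞])` versus Greenberg–Vatsal's strict datum group -/

section Groups

variable {K : Type} [Field K] [NumberField K] (W : WeierstrassCurve K) [W.IsElliptic]
  (p : ℕ) [Fact p.Prime] (κ : ZpExtension K p) (𝔭 : HeightOneSpectrum (𝓞 K))
  (S : Set (HeightOneSpectrum (𝓞 K)))

omit [W.IsElliptic] in
/-- **`Sel_𝔭^S(K_∞, E[p^∞]) ≤ S^{S,str}_{E[p^∞]}(K_∞)`** for Castella's data `bdpData 𝔭` (strict at `𝔭`,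
relaxed at the other places above `p`): locally trivial implies unramified at every finite `v ∉ S`,
`v ∤ p` (`awayKer ≤ unramifiedKer`, Greenberg 1989 p. 98 "one could replace `I_v` by `D_v`"), the
strict conditions at `𝔭` are the same subgroup, and at `v ∣ p`, `v ≠ 𝔭` the relaxed datum imposes
nothing (`strictKer_relaxedDatum_eq_top`). [cite: Castella2018, Def. 2.2 (arXiv:1704.06608 p. 5)]
[cite: GreenbergVatsal2000, §2 pp. 15, 20] -/
theorem selmerAc_le_datumStrictSelmer :
    AcSelmer.selmerAc W p κ 𝔭 S ≤
      datumStrictSelmer κ.kerSubgroup (W.geomPrimaryTorsion p) p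
        (AcSelmer.bdpData (W.geomPrimaryTorsion p) p 𝔭) S := by
  intro c hc
  rw [AcSelmer.selmerAc, AcSelmer.mem_selmerOver_iff] at hc
  obtain ⟨haway, -, hstr⟩ := hc
  rw [mem_datumStrictSelmer_iff, mem_unramifiedOutside_iff]
  refine ⟨fun v hvS hpv σ ↦
    SelmerAcQuotientCorankLeGeneric.awayKer_le_unramifiedKer κ.kerSubgroup (W.geomPrimaryTorsion p) v
      (haway v hpv hvS σ), fun v hv σ ↦ ?_⟩
  by_cases hv𝔭 : v = 𝔭
  · subst hv𝔭
    rw [AcSelmer.bdpData_self p v hv]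
    exact hstr σ
  · rw [AcSelmer.bdpData_of_ne p 𝔭 hv hv𝔭, AcSelmer.strictKer_relaxedDatum_eq_top]
    exact AddSubgroup.mem_top _

/-- **`S^{S,str}_{E[p^∞]}(K_∞) ≤ Sel_𝔭^S(K_∞, E[p^∞])` when the infinite places of `K` are complex,
`𝔭 ∋ p`, and `W` has good reduction at every finite `v ∉ S` with `v ∤ p`.** Place by place over
`K_∞ = K̄^{ker κ}`: at a complex place nothing is imposed (`decompInf = ⊥`); at `𝔭` the two strict
conditions are the same; at a finite `v ∉ S`, `v ∤ p` an unramified class is locally trivial — if `v`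
is finitely decomposed in `K_∞` (`D_v ⊄ ker κ`; `I_v ≤ ker κ` as `ℤ_p`-extensions are unramified outside
`p`) because `Gal(K̄_v/K_{∞,w})/I` is pro-prime-to-`p`, and if `v` splits completely (`D_v ≤ ker κ`) by
Greenberg's Lemma 3.3 at the GOOD place `v` (`H¹_ur(K_v, E[p^∞]) = E[p^∞]^{I_v}/(Frob − 1) = 0`).
[cite: GreenbergLNM1716, §3 Lemma 3.3 (p. 87)] [cite: Greenberg1989, §1 p. 98]
[cite: Castella2018, §2.2 (arXiv:1704.06608 p. 7)] [cite: Washington1997, Prop. 13.2] -/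
theorem datumStrictSelmer_le_selmerAc (hK : ∀ w : InfinitePlace K, w.IsComplex)
    (h𝔭 : ((p : ℕ) : 𝓞 K) ∈ 𝔭.asIdeal)
    (hgood : ∀ v : HeightOneSpectrum (𝓞 K), v ∉ S → ((p : ℕ) : 𝓞 K) ∉ v.asIdeal →
      W.HasGoodReductionAt v) :
    datumStrictSelmer κ.kerSubgroup (W.geomPrimaryTorsion p) p
        (AcSelmer.bdpData (W.geomPrimaryTorsion p) p 𝔭) S ≤ AcSelmer.selmerAc W p κ 𝔭 S := by
  intro a ha
  obtain ⟨hunr, hstr⟩ := (mem_datumStrictSelmer_iff a).1 ha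
  rw [mem_unramifiedOutside_iff] at hunr
  rw [AcSelmer.selmerAc, AcSelmer.mem_selmerOver_iff]
  refine ⟨fun v hpv hvS σ ↦ ?_, fun w σ ↦ ?_, fun σ ↦ ?_⟩
  · have hy := hunr v hvS hpv σ
    by_cases hD : decomp v ≤ κ.kerSubgroup
    · exact SignedBaseChangeAcDivAwayDiscrepancy.mem_awayKer_of_mem_unramifiedKer_of_decomp_le W p hpv
        (hgood v hvS hpv) hD hy
    · have hI : inertia v ≤ κ.kerSubgroup := by
        have e : inertia v = (adicCompletionPrime K v).inertia (absoluteGaloisGroup K) :=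
          (inertia_adicCompletionPrime_eq_map_absInertia K v).symm
        rw [e]
        exact ZpExtension.inertia_le_kerSubgroup_holds K p κ hpv (adicCompletionPrime_mem_primesAbove K v)
      exact UnramifiedLeAwayKer.unramifiedKer_le_awayKer_of_not_decomp_le κ
        (W.isOpen_stabilizer_geomPrimaryTorsion' p) (W.exists_pow_smul_geomPrimaryTorsion_eq_zero p)
        hI hD hy
  · exact Rank1Residual.X11b.Coinv.mem_infKer_of_decompInf_eq_bot w
      (BigGaloisRep.decompInf_eq_bot_of_isComplex (hK w)) _
  · have h := hstr 𝔭 h𝔭 σ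
    rwa [AcSelmer.bdpData_self p 𝔭 h𝔭] at h

/-- **`Sel_𝔭^S(K_∞, E[p^∞]) = S^{S,str}_{E[p^∞]}(K_∞)`** (Castella's anticyclotomic Selmer group IS
Greenberg–Vatsal's strict datum group for `bdpData 𝔭`) when the infinite places of `K` are complex,
`𝔭 ∋ p`, and `W` is good at every finite `v ∉ S`, `v ∤ p` — the dictionary (I9) of the V21 road:
"`S(A_f) = AcSelmer.selmerAc`, awayKer = unramifiedKer at good `w ∉ Sf` for the divisible `E[p^∞]`".
[cite: Castella2018, Def. 2.2 and §2.2 (arXiv:1704.06608 pp. 5, 7)] [cite: GreenbergVatsal2000, §2 pp. 15–17, 20]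
[cite: GreenbergLNM1716, §3 Lemma 3.3 (p. 87)] -/
theorem selmerAc_eq_datumStrictSelmer (hK : ∀ w : InfinitePlace K, w.IsComplex)
    (h𝔭 : ((p : ℕ) : 𝓞 K) ∈ 𝔭.asIdeal)
    (hgood : ∀ v : HeightOneSpectrum (𝓞 K), v ∉ S → ((p : ℕ) : 𝓞 K) ∉ v.asIdeal →
      W.HasGoodReductionAt v) :
    AcSelmer.selmerAc W p κ 𝔭 S =
      datumStrictSelmer κ.kerSubgroup (W.geomPrimaryTorsion p) p
        (AcSelmer.bdpData (W.geomPrimaryTorsion p) p 𝔭) S :=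
  le_antisymm (selmerAc_le_datumStrictSelmer W p κ 𝔭 S)
    (datumStrictSelmer_le_selmerAc W p κ 𝔭 S hK h𝔭 hgood)

/-- The same equality in Keller–Yin's spelling: `Sel_𝔭^S(K_∞, E[p^∞]) = H¹_{𝓕_Gr^S}(K_∞, E[p^∞])`
(`KellerYin2024.grSelmer` = GV's strict datum group over the tower, `datumStrictSelmerInfty_eq`).
[cite: KellerYin2024, §1.2 Def. (1)–(2) and Rem. 1.2.3 (i) (arXiv:2402.12781v2)]
[cite: Castella2018, Def. 2.2 (arXiv:1704.06608 p. 5)] -/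
theorem selmerAc_eq_grSelmer (hK : ∀ w : InfinitePlace K, w.IsComplex)
    (h𝔭 : ((p : ℕ) : 𝓞 K) ∈ 𝔭.asIdeal)
    (hgood : ∀ v : HeightOneSpectrum (𝓞 K), v ∉ S → ((p : ℕ) : 𝓞 K) ∉ v.asIdeal →
      W.HasGoodReductionAt v) :
    AcSelmer.selmerAc W p κ 𝔭 S = KellerYin2024.grSelmer κ (W.geomPrimaryTorsion p) 𝔭 S := by
  rw [KellerYin2024.grSelmer, datumStrictSelmerInfty_eq]
  exact selmerAc_eq_datumStrictSelmer W p κ 𝔭 S hK h𝔭 hgood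

end Groups

/-! ## §2 `λ(X) = corank_{ℤ_p}(Sel)` for a dual `X ≅ Hom(Sel, ℚ/ℤ)`, f.g. torsion over `Λ` with `μ = 0` -/

section Lambda

variable {K : Type} [Field K] [NumberField K] (W : WeierstrassCurve K) [W.IsElliptic]
  (p : ℕ) [Fact p.Prime] (κ : ZpExtension K p) (𝔭 : HeightOneSpectrum (𝓞 K))
  (S : Set (HeightOneSpectrum (𝓞 K))) (γ : absoluteGaloisGroup K)

omit [W.IsElliptic] in
/-- Classes of `Sel_𝔭^S(K_∞, E[p^∞])` are killed by powers of `p` (`Gal(K̄/K_∞)` compact, `E[p^∞]`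
discrete `p`-primary). [cite: GreenbergLNM1716, §1 (after Conj. 1.3)] -/
theorem exists_pow_smul_selmerAc_eq_zero (s : AcSelmer.selmerAc W p κ 𝔭 S) : ∃ k : ℕ, p ^ k • s = 0 := by
  obtain ⟨k, hk⟩ := W.exists_pow_smul_subgroupH1_ker_eq_zero κ (s : W.subgroupH1 p κ.kerSubgroup)
  exact ⟨k, Subtype.ext (by rw [AddSubgroupClass.coe_nsmul]; exact hk)⟩

omit [W.IsElliptic] in
/-- **`Sel_𝔭^S(K_∞, E[p^∞])[p]` is finite and `λ(𝔛_ac^S) = corank_{ℤ_p} Sel_𝔭^S(K_∞, E[p^∞])`** when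
Castella's dual `𝔛_ac^S = AcSelmer.XAc W p κ 𝔭 S γ` is finitely generated and torsion over
`Λ = ℤ_p⟦T⟧` with `μ = 0`: `XAc` IS the character group `Hom(Sel_𝔭^S, ℚ/ℤ)` (by definition), so the
tree's `finite_torsionBy_and_zpCorank_eq_lambdaInvariant` applies with the identity isomorphism
(Greenberg 1999 §1 p. 60 "`λ_E = rank_{ℤ_p} X`"; GV p. 21 "the `corank_𝒪` of a `Λ`-cotorsion group
being the `λ`-invariant of its dual"). [cite: GreenbergLNM1716, §1 p. 60]
[cite: GreenbergVatsal2000, §2 p. 21] [cite: Castella2018, Def. 2.2 (arXiv:1704.06608 p. 5)] -/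
theorem finite_torsionBy_and_lambdaInvariant_XAc_eq_zpCorank [Fact (κ.IsTopGenerator γ)]
    [Module.Finite (IwasawaAlgebra p) (AcSelmer.XAc W p κ 𝔭 S γ)]
    (htor : Module.IsTorsion (IwasawaAlgebra p) (AcSelmer.XAc W p κ 𝔭 S γ))
    (hμ : muInvariant p (AcSelmer.XAc W p κ 𝔭 S γ) = 0) :
    Finite ((AcSelmer.selmerAc W p κ 𝔭 S)[(p : ℤ)]) ∧
      lambdaInvariant p (AcSelmer.XAc W p κ 𝔭 S γ) = zpCorank (AcSelmer.selmerAc W p κ 𝔭 S) p := by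
  obtain ⟨hfin, h⟩ :=
    Rank1Residual.X2.NonPrimitiveSelmerCorank.finite_torsionBy_and_zpCorank_eq_lambdaInvariant p
      (AcSelmer.XAc W p κ 𝔭 S γ) htor hμ (exists_pow_smul_selmerAc_eq_zero W p κ 𝔭 S)
      (AddEquiv.refl (AcSelmer.XAc W p κ 𝔭 S γ))
  exact ⟨hfin, h.symm⟩

variable {p} (M : Type) [AddCommGroup M] [DistribMulAction (absoluteGaloisGroup K) M]
  [TopologicalSpace M] [DiscreteTopology M] (L : Data K M p) (S₀ : Set (HeightOneSpectrum (𝓞 K)))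

/-- **`S^{S₀}_M(K_∞)[p]` is finite and `λ(D.X) = corank_{ℤ_p} S^{S₀}_M(K_∞)`** for ANY Pontryagin-dual
datum `D : DatumDualData κ γ M L S₀` of the Greenberg–Vatsal datum Selmer group of a `p`-primary
discrete module `M`, when `D.X` is finitely generated and torsion over `Λ` with `μ = 0`: `D.toDualEquiv`
identifies `D.X` with `Hom(S^{S₀}_M(K_∞), ℚ/ℤ)` as a group, and `λ` only sees the group (GV p. 21).
[cite: GreenbergVatsal2000, §2 pp. 17, 21] [cite: GreenbergLNM1716, §1 p. 60] -/
theorem finite_torsionBy_and_lambdaInvariant_datumDualData_eq_zpCorank (D : DatumDualData κ γ M L S₀)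
    (hM : ∀ m : M, ∃ k : ℕ, p ^ k • m = 0) [Module.Finite (IwasawaAlgebra p) D.X]
    (htor : Module.IsTorsion (IwasawaAlgebra p) D.X) (hμ : muInvariant p D.X = 0) :
    Finite ((datumSelmerInfty κ M L S₀)[(p : ℤ)]) ∧
      lambdaInvariant p D.X = zpCorank (datumSelmerInfty κ M L S₀) p := by
  have hS : ∀ s : datumSelmerInfty κ M L S₀, ∃ k : ℕ, p ^ k • s = 0 := fun s ↦ by
    obtain ⟨k, hk⟩ := exists_pow_smul_subgroupH1_eq_zero κ M hM (s : subgroupH1 κ.kerSubgroup M)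
    exact ⟨k, Subtype.ext (by rw [AddSubgroupClass.coe_nsmul]; exact hk)⟩
  obtain ⟨hfin, h⟩ :=
    Rank1Residual.X2.NonPrimitiveSelmerCorank.finite_torsionBy_and_zpCorank_eq_lambdaInvariant p D.X htor
      hμ hS D.toDualEquiv
  exact ⟨hfin, h.symm⟩

end Lambda

/-! ## §3 At the crux's binders: `E_K = W.baseChange K`, `K` imaginary quadratic, `vbar ∋ p`, `Sf = {w ∣ N_W}` -/

section Crux

variable (W : WeierstrassCurve ℚ) [W.IsElliptic] (p : ℕ) [Fact p.Prime]
  (K : Type) [Field K] [NumberField K] (vbar : HeightOneSpectrum (𝓞 K)) (κ : ZpExtension K p)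
  (Sf : Finset (HeightOneSpectrum (𝓞 K)))

/-- **`Sel_{v̄}^{Sf}(K_∞, E_K[p^∞]) = S^{Sf,str}_{E_K[p^∞]}(K_∞)` at the crux's data**: `K` imaginary
quadratic (all infinite places complex), `vbar ∋ p`, `Sf` = the places dividing the conductor `N_W`, so
that `E_K = W.baseChange K` has good reduction at every `w ∉ Sf`
(`hasGoodReductionAt_baseChange_of_conductorNorm_notMem`). [cite: Castella2018, Def. 2.2 (arXiv:1704.06608 p. 5)]
[cite: GreenbergVatsal2000, §2 pp. 15–17, 20] [cite: KellerYin2024, Rem. 1.2.3 (i) (arXiv:2402.12781v2)] -/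
theorem selmerAc_baseChange_eq_datumStrictSelmer (hK : IsImaginaryQuadratic K)
    (hvbar : ((p : ℕ) : 𝓞 K) ∈ vbar.asIdeal)
    (hSf : ∀ w : HeightOneSpectrum (𝓞 K), w ∈ Sf ↔ ((W.conductorNorm ℤ : ℤ) : 𝓞 K) ∈ w.asIdeal) :
    AcSelmer.selmerAc (W.baseChange K) p κ vbar (↑Sf : Set (HeightOneSpectrum (𝓞 K))) =
      datumStrictSelmer κ.kerSubgroup ↥((W.baseChange K).geomPrimaryTorsion p) p
        (AcSelmer.bdpData ↥((W.baseChange K).geomPrimaryTorsion p) p vbar)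
        (↑Sf : Set (HeightOneSpectrum (𝓞 K))) := by
  haveI : (W.baseChange K).IsElliptic := by rw [WeierstrassCurve.baseChange]; infer_instance
  refine selmerAc_eq_datumStrictSelmer (W.baseChange K) p κ vbar _ (fun w ↦ hK.2.isComplex w) hvbar
    fun w hwS _ ↦ ?_
  exact EisensteinPrimesMuLambda.hasGoodReductionAt_baseChange_of_conductorNorm_notMem W w
    fun h ↦ hwS (Finset.mem_coe.mpr ((hSf w).mpr h))

/-- **The `f`-side dictionary of `stub_indexPlumbing` (C)**: at the crux's data, if `𝔛^{Sf}_f =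
AcSelmer.XAc E_K p κ vbar ↑Sf γ` is finitely generated and torsion over `Λ` with `μ = 0` (the three
antecedents the v20 plumbing stub carries), then `R(E_K[p^∞])[p]` is finite and
`λ(𝔛^{Sf}_f) = zpCorank R(E_K[p^∞])`, where `R(E_K[p^∞]) = datumStrictSelmer (ker κ) E_K[p^∞] p (bdpData … vbar) ↑Sf`
is the strict group of the mid-level composition `ResidualIndexAssembly.zpCorank_datumStrictSelmer_add_eq`.
[cite: KellerYin2024, Thm. 1.4.1 (iii) (arXiv:2402.12781v2 TeX L1087–1098)] [cite: GreenbergLNM1716, §1 p. 60]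
[cite: Castella2018, Def. 2.2 (arXiv:1704.06608 p. 5)] -/
theorem finite_torsionBy_and_lambdaInvariant_XAc_eq_zpCorank_datumStrictSelmer (hK : IsImaginaryQuadratic K)
    (hvbar : ((p : ℕ) : 𝓞 K) ∈ vbar.asIdeal) (γ : absoluteGaloisGroup K) [Fact (κ.IsTopGenerator γ)]
    (hSf : ∀ w : HeightOneSpectrum (𝓞 K), w ∈ Sf ↔ ((W.conductorNorm ℤ : ℤ) : 𝓞 K) ∈ w.asIdeal)
    [Module.Finite (IwasawaAlgebra p)
      (AcSelmer.XAc (W.baseChange K) p κ vbar (↑Sf : Set (HeightOneSpectrum (𝓞 K))) γ)]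
    (htor : Module.IsTorsion (IwasawaAlgebra p)
      (AcSelmer.XAc (W.baseChange K) p κ vbar (↑Sf : Set (HeightOneSpectrum (𝓞 K))) γ))
    (hμ : muInvariant p (AcSelmer.XAc (W.baseChange K) p κ vbar (↑Sf : Set (HeightOneSpectrum (𝓞 K))) γ) = 0) :
    Finite ((datumStrictSelmer κ.kerSubgroup ↥((W.baseChange K).geomPrimaryTorsion p) p
        (AcSelmer.bdpData ↥((W.baseChange K).geomPrimaryTorsion p) p vbar)
        (↑Sf : Set (HeightOneSpectrum (𝓞 K))))[(p : ℤ)]) ∧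
      lambdaInvariant p (AcSelmer.XAc (W.baseChange K) p κ vbar (↑Sf : Set (HeightOneSpectrum (𝓞 K))) γ) =
        zpCorank (datumStrictSelmer κ.kerSubgroup ↥((W.baseChange K).geomPrimaryTorsion p) p
          (AcSelmer.bdpData ↥((W.baseChange K).geomPrimaryTorsion p) p vbar)
          (↑Sf : Set (HeightOneSpectrum (𝓞 K)))) p := by
  have h := finite_torsionBy_and_lambdaInvariant_XAc_eq_zpCorank (W.baseChange K) p κ vbar
    (↑Sf : Set (HeightOneSpectrum (𝓞 K))) γ htor hμ
  rw [selmerAc_baseChange_eq_datumStrictSelmer W p K vbar κ Sf hK hvbar hSf] at h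
  exact h

/-- **The `θ`-side dictionary of `stub_indexPlumbing` (C)**: for a character `θ : Γ_K → 𝒪^×`
(`𝒪 = ℤ_p`, `padicCoeffIntegers ∅`) and ANY dual datum `DS : DatumDualData κ γ ((F/𝒪)(θ)) (bdpData … vbar) S₀`
of the unramified-at-`v̄` group `S^{S₀}_nr(θ) = datumSelmerInfty κ (charModule ∅ θ) (bdpData … vbar) S₀`
(= `KellerYin2024.unrSelmer`), finitely generated and torsion over `Λ` with `μ = 0`:
`S^{S₀}_nr(θ)[p]` is finite and `λ(DS.X) = zpCorank S^{S₀}_nr(θ)` (`(F/𝒪)(θ)` is `p`-primary: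
`exists_pow_smul_cofree_eq_zero`). [cite: KellerYin2024, §1.2 and Thm. 1.4.1 (iii) (arXiv:2402.12781v2)]
[cite: GreenbergVatsal2000, §2 p. 21] -/
theorem finite_torsionBy_and_lambdaInvariant_datumDualData_charModule_eq_zpCorank
    (γ : absoluteGaloisGroup K) (θ : FramedGaloisRep K (padicCoeffIntegers (∅ : Set (PadicAlgCl p))) 1)
    (S₀ : Set (HeightOneSpectrum (𝓞 K)))
    (DS : DatumDualData κ γ (KellerYin2024.charModule ∅ θ)
      (AcSelmer.bdpData (KellerYin2024.charModule ∅ θ) p vbar) S₀)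
    [Module.Finite (IwasawaAlgebra p) DS.X] (htor : Module.IsTorsion (IwasawaAlgebra p) DS.X)
    (hμ : muInvariant p DS.X = 0) :
    Finite ((datumSelmerInfty κ (KellerYin2024.charModule ∅ θ)
        (AcSelmer.bdpData (KellerYin2024.charModule ∅ θ) p vbar) S₀)[(p : ℤ)]) ∧
      lambdaInvariant p DS.X =
        zpCorank (datumSelmerInfty κ (KellerYin2024.charModule ∅ θ)
          (AcSelmer.bdpData (KellerYin2024.charModule ∅ θ) p vbar) S₀) p :=
  finite_torsionBy_and_lambdaInvariant_datumDualData_eq_zpCorank κ γ (KellerYin2024.charModule ∅ θ) _ S₀ DS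
    (exists_pow_smul_cofree_eq_zero (∅ : Set (PadicAlgCl p)) θ) htor hμ

end Crux

end Summit.BirchSwinnertonDyer.BirchSwinnertonDyer.Theorems.IndexPlumbingDictionary

end
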